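import Mathlib
import HarnessLib
import Summits.Ventures.LatticeQCDFlow.Exactness.U1NearFreeFlight

/-!
# Every kick/drift word on `U(1)` lattice gauge fields is a near-free-flight map with explicit constants

HONEST FRAMING: exact (Metropolis-corrected) sampling algorithms for lattice gauge theory;
figures of merit are autocorrelation/cost numbers at stated couplings and volumes; no
continuum-physics claim.

Venture `LatticeQCDFlow` (cell pub-lqcd), topic `Exactness`, FANOUT row 14 (`eng-flowhmc`, engine
`latflow.fthmc`, family B, `U(1)` rung, EVERY splitting integrator: `leapfrog`, `omf2`, `omf4`, or
any other word of momentum kicks and link drifts).  NEW WORK of the cell over this row's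
`U1NearFreeFlight.lean` (`nearFreeFlight_id/kick/drift` and their bounds); nothing is cited as a
fact; no number.

A WORD is a list of stages, each either a kick `Sum.inl g` (`(v, q) ↦ (v, q + g v)`, `‖g‖ ≤ b`,
`g` `L`-Lipschitz) or a drift `Sum.inr c` (`(v, q) ↦ (e_c(q)·v, q)`, `|c| ≤ c₀`); its map is the
product of the stages (`kick g`, `drift (mulDrift (u1ExpDrift c))`, the head of the list acting
LAST), its total drift is the sum `τ` of its drift coefficients.  THE THEOREM
(**`kickDriftWord_nearFreeFlight`**): if the word has `m` stages and `L c₀ m² ≤ 1/2`, its map is a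
near-free-flight map `(v, q) ↦ (e₁(τ • q + A v q) · v, q + B v q)` with

  `‖A‖ ≤ c₀ b m²`, `‖B‖ ≤ b m`, `Lip A ≤ 2 L c₀ m² · dist + 2 L c₀² m³ · ‖·‖`,
  `Lip B ≤ 2 L m · dist + 2 L c₀ m² · ‖·‖`

(induction on the list: a kick adds `b`, `L(1 + α₁)`, `L(|τ| + α₂)` to the momentum data, a drift
adds `|c| ×` the momentum data to the position data; `abs_driftSum_le`: `|τ| ≤ c₀ m`).  With
`U1NearFreeFlight.nearFreeFlight_iterate_fst/snd` and `U1WordDoeblin` this makes the `n`-fold power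
of ANY such word (OMF4's eleven stages included) Doeblin under an explicit short-trajectory
condition — `U1KickDriftWordErgodic.lean`.  NOT here: kernels; which words are palindromic
(exactness is the word's own business: `SplittingWords`).
-/

noncomputable section

namespace Summit.Ventures.LatticeQCDFlow.Exactness

open Set Metric
open scoped NNReal

variable {ι : Type*} [Fintype ι]

omit [Fintype ι] in
/-- `|τ| ≤ c₀ · (number of stages)` for the total drift of a word whose drift coefficients are
bounded by `c₀ ≥ 0`. -/
theorem abs_driftSum_le {c₀ : ℝ} (hc₀ : 0 ≤ c₀) :
    ∀ stages : List ((((ι → Circle) → ι → ℝ)) ⊕ ℝ), (∀ c, Sum.inr c ∈ stages → |c| ≤ c₀) →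
      |(stages.map fun s => Sum.elim (fun _ => (0 : ℝ)) (fun c => c) s).sum| ≤ c₀ * stages.length := by
  intro stages
  induction stages with
  | nil => intro _; simp
  | cons s rest ih =>
    intro hc
    have ihr := ih fun c hc' => hc c (List.mem_cons_of_mem _ hc')
    rw [List.map_cons, List.sum_cons, List.length_cons, Nat.cast_succ]
    refine (abs_add_le _ _).trans ?_
    cases s with
    | inl g =>
      simp only [Sum.elim_inl, abs_zero, zero_add]
      nlinarith
    | inr c =>
      simp only [Sum.elim_inr]
      have := hc c (List.mem_cons_self)
      nlinarith

/-- **EVERY KICK/DRIFT WORD ON `U(1)^ι` IS A NEAR-FREE-FLIGHT MAP WITH EXPLICIT CONSTANTS.**  Kicks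
bounded by `b` and `L`-Lipschitz, drift coefficients bounded by `c₀`, at most `m` stages,
`L c₀ m² ≤ 1/2`: the word's map is `(v, q) ↦ (e₁(τ • q + A v q) · v, q + B v q)` with `τ` the sum of
the drift coefficients and `‖A‖ ≤ c₀ b k²`, `‖B‖ ≤ b k`, `Lip A ≤ 2Lc₀k²·dist + 2Lc₀²k³·‖·‖`,
`Lip B ≤ 2Lk·dist + 2Lc₀k²·‖·‖`, `k` the number of stages. -/
theorem kickDriftWord_nearFreeFlight {b c₀ : ℝ} {L : ℝ≥0} (hb : 0 ≤ b) (hc₀ : 0 ≤ c₀) {m : ℕ}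
    (hm : (L : ℝ) * c₀ * (m : ℝ) ^ 2 ≤ 1 / 2) :
    ∀ stages : List ((((ι → Circle) → ι → ℝ)) ⊕ ℝ), stages.length ≤ m →
      (∀ g, Sum.inl g ∈ stages → (∀ v, ‖g v‖ ≤ b) ∧ LipschitzWith L g) →
      (∀ c, Sum.inr c ∈ stages → |c| ≤ c₀) →
      ∃ A B : (ι → Circle) → (ι → ℝ) → ι → ℝ,
        (∀ z : (ι → Circle) × (ι → ℝ),
          (stages.map fun s => Sum.elim (fun g => kick g)
            (fun c => drift (mulDrift (u1ExpDrift (ι := ι) c))) s).prod z =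
          (u1ExpDrift 1 ((stages.map fun s => Sum.elim (fun _ => (0 : ℝ)) (fun c => c) s).sum • z.2 +
            A z.1 z.2) * z.1, z.2 + B z.1 z.2)) ∧
        (∀ v q, ‖A v q‖ ≤ c₀ * b * (stages.length : ℝ) ^ 2) ∧
        (∀ v q, ‖B v q‖ ≤ b * stages.length) ∧
        (∀ v v' q q', ‖A v q - A v' q'‖ ≤
          2 * L * c₀ * (stages.length : ℝ) ^ 2 * dist v v' +
            2 * L * c₀ ^ 2 * (stages.length : ℝ) ^ 3 * ‖q - q'‖) ∧
        (∀ v v' q q', ‖B v q - B v' q'‖ ≤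
          2 * L * stages.length * dist v v' + 2 * L * c₀ * (stages.length : ℝ) ^ 2 * ‖q - q'‖) := by
  have hL0 : (0 : ℝ) ≤ L := NNReal.coe_nonneg L
  intro stages
  induction stages with
  | nil =>
    intro _ _ _
    refine ⟨fun _ _ => 0, fun _ _ => 0, fun z => ?_, by simp, by simp, by simp, by simp⟩
    simpa using nearFreeFlight_id (ι := ι) z
  | cons s rest ih =>
    intro hlen hkick hdrift
    have hlen' : rest.length ≤ m := (Nat.le_succ _).trans (by simpa using hlen)
    obtain ⟨A, B, hΦ, hA0, hB0, hA, hB⟩ := ih hlen'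
      (fun g hg => hkick g (List.mem_cons_of_mem _ hg)) (fun c hc => hdrift c (List.mem_cons_of_mem _ hc))
    -- the number of stages so far and the smallness at that length
    set k : ℝ := (rest.length : ℝ) with hk
    have hk0 : 0 ≤ k := Nat.cast_nonneg _
    have hk1 : k + 1 ≤ m := by
      rw [hk]; exact_mod_cast (show rest.length + 1 ≤ m by simpa using hlen)
    have hsmall : (L : ℝ) * c₀ * (k + 1) ^ 2 ≤ 1 / 2 :=
      (mul_le_mul_of_nonneg_left (pow_le_pow_left₀ (by positivity) hk1 2) (by positivity)).trans hm
    have hsmallk : (L : ℝ) * c₀ * k ^ 2 ≤ 1 / 2 :=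
      (mul_le_mul_of_nonneg_left (pow_le_pow_left₀ hk0 (by linarith) 2) (by positivity)).trans hsmall
    have hτ := abs_driftSum_le (ι := ι) hc₀ rest fun c hc => hdrift c (List.mem_cons_of_mem _ hc)
    rw [← hk] at hτ
    have hlen_cons : ((s :: rest).length : ℝ) = k + 1 := by rw [List.length_cons, Nat.cast_succ]
    rw [hlen_cons]
    cases s with
    | inl g =>
      obtain ⟨hbg, hLg⟩ := hkick g List.mem_cons_self
      have hb' := nearFreeFlight_kick_bounds
        (τ := (rest.map fun s => Sum.elim (fun _ => (0 : ℝ)) (fun c => c) s).sum) (A := A) (B := B)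
        hB0 hA hB hbg hLg
      refine ⟨A, fun v q => B v q + g (u1ExpDrift 1
          ((rest.map fun s => Sum.elim (fun _ => (0 : ℝ)) (fun c => c) s).sum • q + A v q) * v),
        fun z => ?_, fun v q => ?_, fun v q => ?_, fun v v' q q' => ?_, fun v v' q q' => ?_⟩
      · rw [List.map_cons, List.prod_cons, Sum.elim_inl, Equiv.Perm.coe_mul, List.map_cons,
          List.sum_cons, Sum.elim_inl, zero_add]
        exact nearFreeFlight_kick hΦ g z
      · exact (hA0 v q).trans (by nlinarith [mul_nonneg hc₀ hb])
      · exact (hb'.1 v q).trans (by linarith)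
      · exact (hA v v' q q').trans (by
          nlinarith [mul_nonneg (mul_nonneg hL0 hc₀) (dist_nonneg (x := v) (y := v')),
            mul_nonneg (mul_nonneg hL0 (sq_nonneg c₀)) (norm_nonneg (q - q')),
            mul_nonneg (mul_nonneg (mul_nonneg hL0 hc₀) hk0) (dist_nonneg (x := v) (y := v')),
            mul_nonneg (mul_nonneg (mul_nonneg hL0 (sq_nonneg c₀)) (sq_nonneg k)) (norm_nonneg (q - q'))])
      · refine (hb'.2 v v' q q').trans ?_
        have h1 : 2 * (L : ℝ) * k + L * (1 + 2 * L * c₀ * k ^ 2) ≤ 2 * L * (k + 1) := by nlinarith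
        have h2 : 2 * (L : ℝ) * c₀ * k ^ 2 + L * (|(rest.map fun s =>
            Sum.elim (fun _ => (0 : ℝ)) (fun c => c) s).sum| + 2 * L * c₀ ^ 2 * k ^ 3) ≤
            2 * L * c₀ * (k + 1) ^ 2 := by
          have h3 : 2 * (L : ℝ) * c₀ ^ 2 * k ^ 3 ≤ c₀ * k := by
            have : 2 * (L : ℝ) * c₀ ^ 2 * k ^ 3 = (2 * (L * c₀ * k ^ 2)) * (c₀ * k) := by ring
            rw [this]
            exact mul_le_of_le_one_left (mul_nonneg hc₀ hk0) (by linarith)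
          nlinarith [mul_le_mul_of_nonneg_left hτ hL0, mul_nonneg hL0 (mul_nonneg hc₀ hk0)]
        nlinarith [mul_le_mul_of_nonneg_right h1 (dist_nonneg (x := v) (y := v')),
          mul_le_mul_of_nonneg_right h2 (norm_nonneg (q - q'))]
    | inr c =>
      have hcc := hdrift c List.mem_cons_self
      have ha' := nearFreeFlight_drift_bounds (A := A) (B := B) hA0 hB0 hA hB c
      refine ⟨fun v q => A v q + c • B v q, B, fun z => ?_, fun v q => ?_, fun v q => ?_,
        fun v v' q q' => ?_, fun v v' q q' => ?_⟩
      · rw [List.map_cons, List.prod_cons, Sum.elim_inr, Equiv.Perm.coe_mul, List.map_cons,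
          List.sum_cons, Sum.elim_inr, add_comm c]
        exact nearFreeFlight_drift hΦ c z
      · refine (ha'.1 v q).trans ?_
        nlinarith [mul_le_mul_of_nonneg_right hcc (mul_nonneg hb hk0), mul_nonneg hc₀ hb,
          mul_nonneg (mul_nonneg hc₀ hb) hk0]
      · exact (hB0 v q).trans (by nlinarith)
      · refine (ha'.2 v v' q q').trans ?_
        have h1 : 2 * (L : ℝ) * c₀ * k ^ 2 + |c| * (2 * L * k) ≤ 2 * L * c₀ * (k + 1) ^ 2 := by
          nlinarith [mul_le_mul_of_nonneg_right hcc (by positivity : (0 : ℝ) ≤ 2 * L * k),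
            mul_nonneg hL0 hc₀]
        have h2 : 2 * (L : ℝ) * c₀ ^ 2 * k ^ 3 + |c| * (2 * L * c₀ * k ^ 2) ≤
            2 * L * c₀ ^ 2 * (k + 1) ^ 3 := by
          nlinarith [mul_le_mul_of_nonneg_right hcc (by positivity : (0 : ℝ) ≤ 2 * L * c₀ * k ^ 2),
            mul_nonneg (mul_nonneg hL0 (sq_nonneg c₀)) hk0,
            mul_nonneg (mul_nonneg hL0 (sq_nonneg c₀)) (sq_nonneg k)]
        nlinarith [mul_le_mul_of_nonneg_right h1 (dist_nonneg (x := v) (y := v')),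
          mul_le_mul_of_nonneg_right h2 (norm_nonneg (q - q'))]
      · exact (hB v v' q q').trans (by
          nlinarith [mul_nonneg hL0 (dist_nonneg (x := v) (y := v')),
            mul_nonneg (mul_nonneg hL0 hc₀) (norm_nonneg (q - q')),
            mul_nonneg (mul_nonneg (mul_nonneg hL0 hc₀) hk0) (norm_nonneg (q - q'))])

end Summit.Ventures.LatticeQCDFlow.Exactness
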